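import Summits.HodgeConjecture.HodgeConjecture.Theses.LinearSystemTorelli
import Literature.AlgebraicGeometry.HodgeTheory.HodgeFiltrationModels
import Literature.AlgebraicGeometry.HodgeTheory.SupportedClassesRationalProofs
import Literature.AlgebraicGeometry.HodgeTheory.VanishingCohomologyNontrivialProofs
import Literature.AlgebraicGeometry.HodgeTheory.ComplexConjugationHolds

/-!
# Route LinearSystemTorelli — support item `ConiveauOneOfVanishingGenus` (stmt-HodgeConjecture-2410)

The support item `ConiveauOneOfVanishingGenus` of route `LinearSystemTorelli` reads: for `p ≥ 1` and
`X` smooth projective of dimension `2p` over `ℂ` with a Hodge model, if `X` has no non-zero class of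
Hodge type `(2p, 0)` then ALL of `H²ᵖ(X(ℂ); ℂ)` is supported in codimension `≥ 1`
(`supportedClasses X (2p) 1 = ⊤`), i.e. Grothendieck's generalized Hodge conjecture GHC(2p, 1) in
the sector `h^{2p,0}(X) = 0`.  As filed it is of GHC strength for `p ≥ 2` (open: Voisin, *Ann. Sci.
ÉNS* 46 (2013), Conj. 0.3 / introduction; the item's own docstring), so this file does NOT close the
item.  It records, sorry-free and against the route's own decls, what IS provable now:

* `linearSystemTorelli_coniveauOneOfVanishingGenus_of_transcendentalOrSupported` — **the item follows
  from the route's crux** `TranscendentalOrSupported` (item stmt-HodgeConjecture-10853, GHC(2p,1) in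
  Grothendieck's sub-Hodge form): apply the crux to a finite rational spanning family of
  `H²ᵖ(X(ℂ); ℂ)` (universal coefficients, `span_isRationalClass_eq_top_of_isSmoothProjective_holds`,
  and finiteness `finite_complexBetti`), whose pulled-back span is everything, hence trivially a
  sub-Hodge structure, and meets `H^{2p,0} = 0`.
* `linearSystemTorelli_supportedClasses_two_one_eq_top` — **the case `p = 1` (surfaces with
  `p_g = 0`) from the rational Lefschetz `(1,1)` theorem** (named fact `lefschetzOneOne_rational`,
  taken as a hypothesis): with a REAL Hodge model (`exists_isReal_hodgeModel_holds`, proved) Hodge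
  symmetry kills `H^{0,2}` as well, so `H²(X^an; ℂ) = H^{1,1}`, every rational class is of type
  `(1,1)`, hence a divisor class (`algebraicClasses X 1 = supportedClasses X 2 1` by definition), and
  rational classes span.
* `linearSystemTorelli_coniveauOneOfVanishingGenus_of_two_le` — hence, granted Lefschetz `(1,1)`,
  **the item reduces to its instances `p ≥ 2`** (fourfolds and up), which are GHC(2p,1)-strength.

Helper lemmas (Hodge models): the vanishing hypothesis empties `H^{2p,0}` of EVERY model
(`…hodgePQ_eq_bot_of_forall_isOfHodgeType`, pull-back to the model is surjective), Hodge symmetry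
swaps empty pieces (`…hodgePQ_eq_bot_of_isHodgeSymmetric`), the pieces `H^{p',q'}`, `p' + q' = k`,
span in the crux's indexing (`…iSup_hodgePQ_eq_top`), and finite rational spanning families exist
(`…exists_fin_isRationalClass_span_eq_top`).

References: A. Grothendieck, *Hodge's general conjecture is false for trivial reasons*, Topology 8
(1969); C. Voisin, *Hodge Theory and Complex Algebraic Geometry I* (2002), §6.1.3 Cor. 6.12, §7.1.1,
Thm. 11.30 and §11.3.2; C. Voisin, *The generalized Hodge and Bloch conjectures are equivalent for
general complete intersections*, Ann. Sci. ÉNS 46 (2013).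
-/

-- `Summit.HodgeConjecture.HodgeConjecture.Theorems` is the mandated namespace (single-conjunct summit:
-- Sub = Summit), which `linter.dupNamespace` flags on every declaration; the lakefile turns the
-- linter off tree-wide (weak option), restated here so stand-alone elaboration is warning-free too.
set_option linter.dupNamespace false

noncomputable section

namespace Summit.HodgeConjecture.HodgeConjecture.Theorems

open Literature.AlgebraicGeometry.HodgeTheory Literature.AlgebraicGeometry.Motives
open Literature.AlgebraicTopology.SingularHomology

variable {n : ℕ} {X : SchemeOver ℂ}

/-! ### Hodge-model lemmas -/

/-- If every class of `Hᵏ(X(ℂ); ℂ)` of Hodge type `(a, b)` vanishes, then the piece `H^{a,b}` of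
EVERY Hodge model `A` of `X` is zero: a class of `H^{a,b}(A)` is the pull-back of some class of
`X(ℂ)` (the comparison map is a homeomorphism, `HodgeModel.pullback_surjective`), which is then of
type `(a, b)` with witness `A`. [cite: VoisinHodgeI2002, §7.1.1] -/
theorem linearSystemTorelli_hodgePQ_eq_bot_of_forall_isOfHodgeType (A : HodgeModel n X) {k a b : ℕ}
    (h0 : ∀ c : complexBetti X k, IsOfHodgeType n X k a b c → c = 0) :
    A.hodgePQ k a b = ⊥ := by
  rw [eq_bot_iff]
  intro y hy
  obtain ⟨c, rfl⟩ := A.pullback_surjective k y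
  have hc : c = 0 := h0 c ⟨A, hy⟩
  rw [hc, map_zero]
  exact Submodule.zero_mem _

/-- Hodge symmetry swaps vanishing pieces: in a Hodge symmetric model (`conj H^{a,b} ⊆ H^{b,a}`,
Voisin I Cor. 6.12), `H^{a,b} = 0` forces `H^{b,a} = 0` (`conj` is an involution).
[cite: VoisinHodgeI2002, Cor. 6.12] -/
theorem linearSystemTorelli_hodgePQ_eq_bot_of_isHodgeSymmetric (A : HodgeModel n X)
    (hA : A.IsHodgeSymmetric) {k a b : ℕ} (hab : A.hodgePQ k a b = ⊥) :
    A.hodgePQ k b a = ⊥ := by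
  rw [eq_bot_iff]
  intro y hy
  have h1 : conjClass A.carrier k y ∈ A.hodgePQ k a b := hA k b a y hy
  rw [hab, Submodule.mem_bot] at h1
  rw [Submodule.mem_bot, ← conjClass_conjClass y, h1, conjClass_zero]

/-- The pieces `H^{p',q'}`, `p' + q' = k`, of a Hodge model span `Hᵏ(X^an; ℂ)` — the Hodge
decomposition of the model (`HodgeModel.hodgeFiltration_zero`: `F⁰ = ⊤`), in the indexing
`⨆ p' q' (_ : p' + q' = k)` used by the route's crux `TranscendentalOrSupported`.
[cite: VoisinHodgeI2002, Thm. 6.18 and §7.1.1] -/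
theorem linearSystemTorelli_iSup_hodgePQ_eq_top (A : HodgeModel n X) (k : ℕ) :
    ⨆ (p' : ℕ) (q' : ℕ) (_ : p' + q' = k), A.hodgePQ k p' q' = ⊤ := by
  have h := A.hodgeFiltration_zero k
  rw [HodgeModel.hodgeFiltration] at h
  rw [eq_top_iff, ← h]
  exact iSup_le fun p' ↦ iSup_le fun q' ↦ iSup_le fun hpq ↦ iSup_le fun _ ↦
    le_iSup_of_le p' (le_iSup_of_le q' (le_iSup_of_le hpq le_rfl))

/-- **Finite rational spanning families.** For `X` smooth projective, `Hᵏ(X(ℂ); ℂ)` is spanned over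
`ℂ` by finitely many RATIONAL classes: rational classes span
(`span_isRationalClass_eq_top_of_isSmoothProjective_holds`, universal coefficients, Voisin I §7.1.1)
and a linearly independent spanning subfamily of them is finite because `Hᵏ(X(ℂ); ℂ)` is
finite-dimensional (`finite_complexBetti`). [cite: VoisinHodgeI2002, §7.1.1] -/
theorem linearSystemTorelli_exists_fin_isRationalClass_span_eq_top (hX : IsSmoothProjective n X)
    (k : ℕ) :
    ∃ (r : ℕ) (b : Fin r → complexBetti X k), (∀ j, IsRationalClass (b j)) ∧
      Submodule.span ℂ (Set.range b) = ⊤ := by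
  haveI : Module.Finite ℂ (complexBetti X k) := finite_complexBetti hX k
  obtain ⟨t, ht, hspan, hli⟩ :=
    exists_linearIndependent ℂ {c : complexBetti X k | IsRationalClass c}
  have htfin : t.Finite := hli.set_finite_of_isNoetherian
  haveI : Fintype t := htfin.fintype
  refine ⟨Fintype.card t, (↑) ∘ (Fintype.equivFin t).symm,
    fun j ↦ ht ((Fintype.equivFin t).symm j).2, ?_⟩
  rw [EquivLike.range_comp, Subtype.range_coe, hspan]
  exact span_isRationalClass_eq_top_of_isSmoothProjective_holds n X hX k

/-! ### The item follows from the crux `TranscendentalOrSupported` -/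

/-- **`TranscendentalOrSupported → ConiveauOneOfVanishingGenus`** (the support item
stmt-HodgeConjecture-2410 is the `h^{2p,0} = 0` sector of the crux stmt-HodgeConjecture-10853).
Given `p ≥ 1`, `X` smooth projective of dimension `2p`, a Hodge model `A` and the vanishing of all
classes of type `(2p, 0)`: pick a finite rational family `b` spanning `H²ᵖ(X(ℂ); ℂ)`
(`…exists_fin_isRationalClass_span_eq_top`); its pulled-back span `W` is all of `H²ᵖ(X^an; ℂ)`
(pull-back along the comparison homeomorphism is surjective), so `W = ⨆_{p'+q'=2p} W ⊓ H^{p',q'}`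
is the Hodge decomposition of the model (`…iSup_hodgePQ_eq_top`) and `W ⊓ H^{2p,0} = H^{2p,0} = 0`
(`…hodgePQ_eq_bot_of_forall_isOfHodgeType`); the crux puts every `b j` in `N¹ H²ᵖ`, a subspace,
hence `N¹ H²ᵖ = ⊤`. [cite: GrothendieckTopology1969, §1 and footnote 13] -/
theorem linearSystemTorelli_coniveauOneOfVanishingGenus_of_transcendentalOrSupported
    (hT : Summit.HodgeConjecture.HodgeConjecture.Theses.LinearSystemTorelli.TranscendentalOrSupported) :
    Summit.HodgeConjecture.HodgeConjecture.Theses.LinearSystemTorelli.ConiveauOneOfVanishingGenus := by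
  unfold Summit.HodgeConjecture.HodgeConjecture.Theses.LinearSystemTorelli.ConiveauOneOfVanishingGenus
  intro p X hp hX hA h0
  obtain ⟨A⟩ := hA
  obtain ⟨r, b, hb, hspan⟩ := linearSystemTorelli_exists_fin_isRationalClass_span_eq_top hX (2 * p)
  -- the pulled-back span is everything
  have hW : (Submodule.span ℂ (Set.range b)).map (A.pullback (2 * p)).hom = ⊤ := by
    rw [hspan, Submodule.map_top, LinearMap.range_eq_top]
    exact A.pullback_surjective (2 * p)
  have h20 : A.hodgePQ (2 * p) (2 * p) 0 = ⊥ :=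
    linearSystemTorelli_hodgePQ_eq_bot_of_forall_isOfHodgeType A h0
  -- sub-Hodge condition: the Hodge decomposition of the model
  have hsub : (Submodule.span ℂ (Set.range b)).map (A.pullback (2 * p)).hom =
      ⨆ (p' : ℕ) (q' : ℕ) (_ : p' + q' = 2 * p),
        (Submodule.span ℂ (Set.range b)).map (A.pullback (2 * p)).hom ⊓ A.hodgePQ (2 * p) p' q' := by
    rw [hW]
    simp only [top_inf_eq]
    exact (linearSystemTorelli_iSup_hodgePQ_eq_top A (2 * p)).symm
  -- no `(2p, 0)`-part
  have hbot : (Submodule.span ℂ (Set.range b)).map (A.pullback (2 * p)).hom ⊓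
      A.hodgePQ (2 * p) (2 * p) 0 = ⊥ := by
    rw [h20, inf_bot_eq]
  have hmem : ∀ j, b j ∈ supportedClasses X (2 * p) 1 := hT hp hX A r b hb hsub hbot
  rw [eq_top_iff, ← hspan, Submodule.span_le]
  rintro _ ⟨j, rfl⟩
  exact hmem j

/-! ### The case `p = 1`: surfaces with `p_g = 0`, from Lefschetz `(1,1)` -/

/-- **The `p = 1` instance from the rational Lefschetz `(1,1)` theorem.** For `X` a smooth
projective surface over `ℂ` with no non-zero class of type `(2, 0)` (`p_g = 0`), every class of
`H²(X(ℂ); ℂ)` is supported on a divisor: `N¹ H² = ⊤`, granted the named fact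
`lefschetzOneOne_rational` (Voisin I, Thm. 11.30 with Cor. 11.34).  Proof: take a REAL Hodge model
`A` (`exists_isReal_hodgeModel_holds`); `H^{2,0}(A) = 0` by the hypothesis and `H^{0,2}(A) = 0` by
Hodge symmetry (Voisin I Cor. 6.12), so the Hodge decomposition collapses to `H²(X^an; ℂ) = H^{1,1}`
and every class of `X(ℂ)` is of type `(1,1)`; a rational one is then a divisor class
(`lefschetzOneOne_rational`: `c ∈ algebraicClasses X 1 = supportedClasses X 2 1`), and rational
classes span `H²(X(ℂ); ℂ)` (`span_isRationalClass_eq_top_of_isSmoothProjective_holds`).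
[cite: VoisinHodgeI2002, Thm. 11.30, Cor. 11.34 and §11.3.2] -/
theorem linearSystemTorelli_supportedClasses_two_one_eq_top (hL : lefschetzOneOne_rational)
    (hX : IsSmoothProjective (2 * 1) X)
    (h0 : ∀ c : complexBetti X (2 * 1), IsOfHodgeType (2 * 1) X (2 * 1) (2 * 1) 0 c → c = 0) :
    supportedClasses X (2 * 1) 1 = ⊤ := by
  -- a real, hence Hodge symmetric, model
  obtain ⟨A, hAreal⟩ := exists_isReal_hodgeModel_holds (2 * 1) X hX
  have hAs : A.IsHodgeSymmetric := hAreal.isHodgeSymmetric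
  have h20 : A.hodgePQ (2 * 1) (2 * 1) 0 = ⊥ :=
    linearSystemTorelli_hodgePQ_eq_bot_of_forall_isOfHodgeType A h0
  have h02 : A.hodgePQ (2 * 1) 0 (2 * 1) = ⊥ :=
    linearSystemTorelli_hodgePQ_eq_bot_of_isHodgeSymmetric A hAs h20
  -- every class pulls back into `H^{1,1}`
  have h11 : ∀ c : complexBetti X (2 * 1), A.pullback (2 * 1) c ∈ A.hodgePQ (2 * 1) 1 1 := by
    intro c
    have hc : A.pullback (2 * 1) c ∈ A.hodgeFiltration (2 * 1) 0 := by
      rw [A.hodgeFiltration_zero]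
      exact Submodule.mem_top
    rw [HodgeModel.hodgeFiltration] at hc
    have key : (⨆ (p' : ℕ) (q' : ℕ) (_ : p' + q' = 2 * 1) (_ : 0 ≤ p'), A.hodgePQ (2 * 1) p' q') ≤
        A.hodgePQ (2 * 1) 1 1 := by
      refine iSup_le fun p' ↦ iSup_le fun q' ↦ iSup_le fun hpq ↦ iSup_le fun _ ↦ ?_
      rcases Nat.lt_trichotomy p' 1 with hlt | rfl | hgt
      · obtain rfl : p' = 0 := by omega
        obtain rfl : q' = 2 * 1 := by omega
        rw [h02]
        exact bot_le
      · obtain rfl : q' = 1 := by omega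
        exact le_rfl
      · obtain rfl : p' = 2 * 1 := by omega
        obtain rfl : q' = 0 := by omega
        rw [h20]
        exact bot_le
    exact key hc
  -- rational classes are divisor classes (Lefschetz (1,1)), and they span
  have hrat : ∀ c : complexBetti X (2 * 1), IsRationalClass c → c ∈ supportedClasses X (2 * 1) 1 :=
    fun c hc ↦ hL hX c hc ⟨A, h11 c⟩
  rw [eq_top_iff, ← span_isRationalClass_eq_top_of_isSmoothProjective_holds (2 * 1) X hX (2 * 1),
    Submodule.span_le]
  intro c hc
  exact hrat c hc

/-- The `p = 1` specialisation of the item's statement, verbatim, granted `lefschetzOneOne_rational`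
(the Hodge-model hypothesis is not even needed: a real model exists for every smooth projective
`X`). [cite: VoisinHodgeI2002, §11.3.2] -/
theorem linearSystemTorelli_coniveauOneOfVanishingGenus_one (hL : lefschetzOneOne_rational) :
    ∀ ⦃X : SchemeOver ℂ⦄, IsSmoothProjective (2 * 1) X → Nonempty (HodgeModel (2 * 1) X) →
      (∀ c : complexBetti X (2 * 1), IsOfHodgeType (2 * 1) X (2 * 1) (2 * 1) 0 c → c = 0) →
      supportedClasses X (2 * 1) 1 = ⊤ :=
  fun _ hX _ h0 ↦ linearSystemTorelli_supportedClasses_two_one_eq_top hL hX h0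

/-- **Reduction of the item to `p ≥ 2`.** Granted the rational Lefschetz `(1,1)` theorem, the
support item `ConiveauOneOfVanishingGenus` holds as soon as its instances with `p ≥ 2` hold
(smooth projective `2p`-folds with `h^{2p,0} = 0`, `p ≥ 2`: GHC(2p, 1) in that sector — open in
general, e.g. for non-uniruled fourfolds with `h^{4,0} = 0 ≠ h^{3,1}`). [cite: VoisinHodgeI2002, §11.3.2]
[cite: GrothendieckTopology1969, §1 and footnote 13] -/
theorem linearSystemTorelli_coniveauOneOfVanishingGenus_of_two_le (hL : lefschetzOneOne_rational)
    (h2 : ∀ ⦃p : ℕ⦄ ⦃X : SchemeOver ℂ⦄, 2 ≤ p → IsSmoothProjective (2 * p) X →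
      Nonempty (HodgeModel (2 * p) X) →
      (∀ c : complexBetti X (2 * p), IsOfHodgeType (2 * p) X (2 * p) (2 * p) 0 c → c = 0) →
      supportedClasses X (2 * p) 1 = ⊤) :
    Summit.HodgeConjecture.HodgeConjecture.Theses.LinearSystemTorelli.ConiveauOneOfVanishingGenus := by
  unfold Summit.HodgeConjecture.HodgeConjecture.Theses.LinearSystemTorelli.ConiveauOneOfVanishingGenus
  intro p X hp hX hA h0
  rcases Nat.lt_or_ge p 2 with hlt | hge
  · obtain rfl : p = 1 := by omega
    exact linearSystemTorelli_supportedClasses_two_one_eq_top hL hX h0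
  · exact h2 hge hX hA h0

end Summit.HodgeConjecture.HodgeConjecture.Theorems

end
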